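import Literature.MathematicalPhysics.QuantumFieldTheory.Balaban1983to89.B9SectBCodedChainRG2
import Literature.MathematicalPhysics.QuantumFieldTheory.Balaban1983to89.B9SectBFramesSelY

/-!
# `Balaban1983to89.B9SectBGFramesSelY` — T. Bałaban, *Propagators for lattice gauge theories in a background field*, Commun. Math. Phys. **99** (1985)
# 389–434 [Balaban1985BackgroundPropagators], Thm 3.4 p. 400, Thm 3.3 p. 399, Sect. B pp. 400–407, (3.35)–(3.37) p. 396: THE G-SIDE SECT.-B FRAME
# CONSTRUCTORS (`GFrame₅`, `H1GFrame₆`, `E4H2GFrame₆`) WITH THE AVERAGING-TRANSPORTER LAWS GUARDED BY (3.35) (pub-ymgap N06 [B9]; cure (α) of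
# ⚑ LOCATED-29, module S2 — the `…Sel` twin of `B9SectBCodedChainRG1`)

statement-level skeleton of published theorems with citation tags; proofs where landed; nothing here is a claim about the Yang–Mills mass gap

THE PRINT.  Theorem 3.3 (p. 399) and its Sect.-B step for `G(U′U)` ((3.82)–(3.86) p. 407) concern configurations `U` in (3.35) and `U′` in (3.37); the
averaging operators (3.21) inside `H_a(U)`, `Δ_a(U)`, `G(U)` are read there only.

WHY THIS FILE (director-ym №383 CASCADE-K, seat dag-n06-c; ⚑ LOCATED-29, node00-def-Y RULING (α), INTENT-8 GO).  `B9SectBCodedChainRG1` is the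
guarded-`hunitA` edition of the G-side constructors; its remaining averaging-transporter laws `hpar ∕ hunit ∕ hunitX` are still displayed at every `G`-valued
configuration.  THIS FILE is their guarded edition by the device of `B9SectBParSelY` (module S1 `B9SectBFramesSelY` for the parents): `gFrame₅CodedOnSel`
(parent `cinvFrame₃CodedOnSel`; the G letter `GbC` read at the selected transporter; `reg_ginv ∕ readG342` derive the regime from `hparG`, `writeG342` from
`hparC`; `gb_eq_cplx` is transporter-generic), `h1GFrame₆CodedOnSel`, `e4h2GFrame₆CodedOnSel` (the transfers `h1G_transfer_KACU` ∕ `e4h2G_transfer_KACU` at the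
base of a (3.37) pair after the regime rewrite).  Displayed binders = RG1's with `hpar hunit hunitX` replaced by `hparG hparC hunitG hunitXG`; structure
types, families (`KSC`, `KACU … (GAY … par parB (GpY par)) parB`, `pullS (CinvY … par)`) and every generic step theorem UNCHANGED.

HONEST SCOPE.  Re-threading bookkeeping; every field is RG1's proof term at the selected transporter; nothing of [B9] asserted beyond RG1's displayed
hypotheses (now weaker); COUNT-NEUTRAL; N06 NOT discharged; one finite lattice programme — nothing continuum ∕ OS ∕ mass-gap ∕ Clay.  Cell `pub-ymgap`
(HUMAN RULING D-0062), Track A node N06 [B9], CASCADE-K (№383), cure (α) of LOCATED-29, module S2.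

RELATED IN THE TREE, NOT DUPLICATED: `B9SectBCodedChainRG1` (the `hunitA`-guarded originals `gFrame₅CodedOn ∕ h1GFrame₆CodedOn ∕ e4h2GFrame₆CodedOn`),
`B9SectBGFrameCodedY[R]`, `B9SectBH1GFrameCodedY[R]`, `B9SectBE4H2GFrameCodedY[R]` (letters, laws, transfers), `B9SectBFramesSelY` (`cinvFrame₃CodedOnSel`),
`B9SectBParSelY` (the device) — USED BY NAME; no existing module modified.
-/

noncomputable section

namespace Literature.MathematicalPhysics.QuantumFieldTheory.Balaban1983to89.B9SectBGFramesSelY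

open Literature.MathematicalPhysics.QuantumFieldTheory.Balaban1983to89.B9SectBParSelY
open Literature.MathematicalPhysics.QuantumFieldTheory.Balaban1983to89.B9SectBFramesSelY (gpFrame₂CodedOnSel cinvFrame₃CodedOnSel)

variable {d ℓ : ℕ} {hd : 1 ≤ d + 1} {hL : Odd (ℓ + 1) ∧ 1 < ℓ + 1} {b₀ b₁ : ℝ} {Mstar : ℕ}
variable {𝔸 : Type} [NormedRing 𝔸] (P : B9SectBCodedClassR.RegExtraY d ℓ hd hL b₀ b₁ Mstar 𝔸) [NormedAlgebra ℂ 𝔸] [CompleteSpace 𝔸]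

/-! ## GFrame — the root G frame -/

section GFrame

open Literature.MathematicalPhysics.QuantumFieldTheory.Balaban1983to89.B9SectBGFrameCodedYR hiding gFrame₅CodedOn stepEPos_KACU_frame_on
open Literature.MathematicalPhysics.QuantumFieldTheory.Balaban1983to89.B9SectBCodedClassR (RegExtraY bg9YC)
open Literature.MathematicalPhysics.QuantumFieldTheory.Balaban1983to89.B9SectBGFrameCodedY hiding CrossReadY readG342_base crossReadY_KACU gFrame₅CodedOn stepEPos_KACU_frame_on
open Literature.MathematicalPhysics.QuantumFieldTheory.Balaban1983to89
open Literature.MathematicalPhysics.QuantumFieldTheory.Balaban1983to89.Node00 (SiteY BlkY FBondY IBondY CfgY SiteParY BondOpY BondParY UboxY shiftY GpY GAY XY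
  deltaAY deltaPrimeAY bondCoordsY bondFunCoordsY)
open Literature.MathematicalPhysics.QuantumFieldTheory.Balaban1983to89.B6Ineq2142KLevelV1 (β)
open Literature.MathematicalPhysics.QuantumFieldTheory.Balaban1983to89.B6KLevelCensusIndexV1 (KIdx kGeo)
open Literature.MathematicalPhysics.QuantumFieldTheory.Balaban1983to89.B6RandomWalk (HasMajorant hasMajorant_mono Ineq261)
open Literature.MathematicalPhysics.QuantumFieldTheory.Balaban1983to89.B9Thm34Ext (toB6)
open Literature.MathematicalPhysics.QuantumFieldTheory.Balaban1983to89.B9FromB6 (EBlock)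
open Literature.MathematicalPhysics.QuantumFieldTheory.Balaban1983to89.B9GeoNormsKLevelV1 (geo9K geo9K_dist_nonneg)
open Literature.MathematicalPhysics.QuantumFieldTheory.Balaban1983to89.B9Eq39Adjoint (covD covDstar prodCfg plaqU)
open Literature.MathematicalPhysics.QuantumFieldTheory.Balaban1983to89.B9Eq352DivFormLetters (conj)
open Literature.MathematicalPhysics.QuantumFieldTheory.Balaban1983to89.B9Eq352GradLetters (diffLetter)
open Literature.MathematicalPhysics.QuantumFieldTheory.Balaban1983to89.B9Eq371GradLetters (bT bU)
open Literature.MathematicalPhysics.QuantumFieldTheory.Balaban1983to89.B9Eq372RemLetters (lapDDLetter)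
open Literature.MathematicalPhysics.QuantumFieldTheory.Balaban1983to89.B9Eq382V3Letters (dPrimeLetter)
open Literature.MathematicalPhysics.QuantumFieldTheory.Balaban1983to89.B9Eq376POneLetters (conjHom gradLin divLin)
open Literature.MathematicalPhysics.QuantumFieldTheory.Balaban1983to89.B9Eq386Neumann (deltaA)
open Literature.MathematicalPhysics.QuantumFieldTheory.Balaban1983to89.B9Eq360DeltaPrimeAY (AfldY)
open Literature.MathematicalPhysics.QuantumFieldTheory.Balaban1983to89.B9PinMembersKLevelV1 (MemberY geo9Y bg9Y)
open Literature.MathematicalPhysics.QuantumFieldTheory.Balaban1983to89.B9SectBGpLettersY (decY decY_base decY_prod GVal blkC coordC expAC GopC norm_le_one_and_inv_of_mem)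
open Literature.MathematicalPhysics.QuantumFieldTheory.Balaban1983to89.B9SectBL2DictionaryY (coordC_base_eq)
open Literature.MathematicalPhysics.QuantumFieldTheory.Balaban1983to89.B9SectBKerLettersY (QcC QcsC CopC repY blkC_repY repY_injective)
open Literature.MathematicalPhysics.QuantumFieldTheory.Balaban1983to89.B9SectBGpFrameCodedYR (codingYx)
open Literature.MathematicalPhysics.QuantumFieldTheory.Balaban1983to89.B9SectBGpFrameCodedY (CplxLettersY)
open Literature.MathematicalPhysics.QuantumFieldTheory.Balaban1983to89.B9SectBKerFrameCodedYR (cinvFrame₃CodedOn CinvY)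
open Literature.MathematicalPhysics.QuantumFieldTheory.Balaban1983to89.B9SectBCodedCarrier (CCfg pullS)
open Literature.MathematicalPhysics.QuantumFieldTheory.Balaban1983to89.B9SectBCodedReadingsUR (KACU)
open Literature.MathematicalPhysics.QuantumFieldTheory.Balaban1983to89.B9SectBGpReadingsYR (KSC)
open Literature.MathematicalPhysics.QuantumFieldTheory.Balaban1983to89.B9SectBGpTransferInY (eBlock_mono)
open Literature.MathematicalPhysics.QuantumFieldTheory.Balaban1983to89.B9SectBStepWhole (StepEPos)
open Literature.MathematicalPhysics.QuantumFieldTheory.Balaban1983to89.B9SectBGFrameV5 (GFrame₅ stepEPos_of_gFrame₅)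
open Literature.MathematicalPhysics.QuantumFieldTheory.Balaban1983to89.B9SectBGWordDeltaAY (GbC QbC QsbC abC F₂C F₂sC LapBC word_mul_GbC GbC_eq_of_two_sided
  qbC_prod qsbC_prod)
open Literature.MathematicalPhysics.QuantumFieldTheory.Balaban1983to89.B9SectBGReadCodedYR (readG342_GbC_printed writeG342_GbC)
open Literature.MathematicalPhysics.QuantumFieldTheory.Balaban1983to89.B9SectBGReadCodedY (eta_inv_eq_abs_cf hasMajorant_of_eq GbC_eq_conj_bondOpCoordsRY hasMajorant_diffLetter_inr_mul hasMajorant_mul_diffLetter_inl)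
open Literature.MathematicalPhysics.QuantumFieldTheory.Balaban1983to89.B9RWSumsReadsNbr (nbr)
open Literature.MathematicalPhysics.QuantumFieldTheory.Balaban1983to89.B9SectBGReadYR (eBlock_kernelFamilyB_of_KACU_base)
open Literature.MathematicalPhysics.QuantumFieldTheory.Balaban1983to89.Node00.OpsYRead342CrossB (hasMajorant_conj_cdsB_O_of_eBlockB hasMajorant_conj_O_cdB_of_eBlockB)
open Literature.MathematicalPhysics.QuantumFieldTheory.Balaban1983to89.B9SectBGClassLettersY (stencilFB_blkC stencilSt_blkC stencilLoc_blkC Reg335PlaqY CplxLettersGY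
  VarParBY)
open Literature.MathematicalPhysics.QuantumFieldTheory.Balaban1983to89.B9GeoLemma21KLevelV1 (geo9K_one_le_L)
open Literature.MathematicalPhysics.QuantumFieldTheory.Balaban1983to89.B9Thm31SiteCurvatureCommutatorsY (shiftY_shiftY_comm)
open Literature.MathematicalPhysics.QuantumFieldTheory.Balaban1983to89.B9SectBQSizesY (hasMajorant_QbC hasMajorant_QsbC hasMajorant_abC)
open Literature.MathematicalPhysics.QuantumFieldTheory.Balaban1983to89.B9SectBQVariationY (hasMajorant_F₂C hasMajorant_F₂sC)

variable [NormOneClass 𝔸] [FiniteDimensional ℝ 𝔸] {J : Type} (f : J → MemberY d ℓ hd hL b₀ b₁ Mstar)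
  [∀ x : MemberY d ℓ hd hL b₀ b₁ Mstar, Fintype (geo9Y x).Site]
  [instDS : ∀ x : MemberY d ℓ hd hL b₀ b₁ Mstar, DecidableEq (geo9Y x).Site] [instNE : ∀ x : MemberY d ℓ hd hL b₀ b₁ Mstar, Nonempty (geo9Y x).Site]
  (c35 : ℝ) (G : Subgroup 𝔸ˣ) (par : ∀ j : J, SiteParY 𝔸 (f j).toKIdx) (parB : ∀ j : J, BondParY 𝔸 (f j).toKIdx)
  {ι : Type} [Fintype ι] [DecidableEq ι] (b : Module.Basis ι ℝ 𝔸) (ιB : ∀ j : J, BlkY (f j).toKIdx → IBondY (f j).toKIdx)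
  (C37 C38 : ∀ j : J, ℝ → CfgY 𝔸 (f j).toKIdx → AfldY 𝔸 (f j).toKIdx → Prop)

/-- ★★★ **THE G FRAME `GFrame₅` OVER THE CODED CARRIERS OF A SUBFAMILY, AVERAGING-TRANSPORTER LAWS GUARDED** — `B9SectBGFrameCodedYRG.gFrame₅CodedOn` on the
parent `cinvFrame₃CodedOnSel`, the G letter `GbC` read at the selected transporter `parSelC G _ (par j) c`; displayed laws `hparG ∕ hparC ∕ hunitG ∕ hunitXG`
(guarded by (3.35) above the thresholds, resp. by the coded class (3.37)) in place of `hpar ∕ hunit ∕ hunitX`; all other binders, constants and fields as in RG1.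
[cite: Balaban1985BackgroundPropagators, Thm 3.4 p.400, Thm 3.3 p.399, (3.15) p.393, (3.24)–(3.27) pp.394–395, (3.35)–(3.37) p.396, (3.42) p.397, (3.80)–(3.86) pp.406–407, Thm 3.11 p.416; Balaban1984PropagatorsII, (2.51) p.232] -/
noncomputable def gFrame₅CodedOnSel (hι : ∀ (j : J) (s : BlkY (f j).toKIdx), β (f j).toKIdx.hN (f j).toKIdx.D (f j).toKIdx.hk (ιB j s) = s)
    (hG1 : ∀ u : 𝔸ˣ, u ∈ G → ‖(u : 𝔸)‖ ≤ 1)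
    (M₂ : ℝ) (hM₂ : 0 ≤ M₂) (hrepr : ∀ (v : 𝔸) (j : ι), |b.repr v j| ≤ M₂ * ‖v‖) (hcR : 0 < M₂ * ∑ j, ‖b j‖)
    (Cq : ℝ) (hCq : 0 ≤ Cq) (hC37 : ∀ j β' U a, C37 j β' U a → GVal G (f j).toKIdx U ∧ CplxLettersY G (f j) (par j) (ιB j) Cq β' U a)
    (MInv aInv aW : ℝ) (hMInv : 0 < MInv) (haInv : 0 < aInv) (haW : 0 < aW)
    (hparG : ∀ j (α₀ : ℝ) (U : CfgY 𝔸 (f j).toKIdx), MInv ≤ (geo9Y (f j)).M → 0 < α₀ → (geo9Y (f j)).M * α₀ ≤ aInv →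
      (bg9YC 𝔸 G P (f j)).Reg335 c35 α₀ U → ∀ z w, par j U z w ∈ G)
    (hparC : ∀ j β' U a, C37 j β' U a → ∀ z w, par j U z w ∈ G)
    (hunitG : ∀ j (α₀ : ℝ) (U : CfgY 𝔸 (f j).toKIdx), MInv ≤ (geo9Y (f j)).M → 0 < α₀ → (geo9Y (f j)).M * α₀ ≤ aInv →
      (bg9YC 𝔸 G P (f j)).Reg335 c35 α₀ U → IsUnit (deltaPrimeAY (f j).toKIdx (par j) U))
    (hunitXG : ∀ j (α₀ : ℝ) (U : CfgY 𝔸 (f j).toKIdx), MInv ≤ (geo9Y (f j)).M → 0 < α₀ → (geo9Y (f j)).M * α₀ ≤ aInv →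
      (bg9YC 𝔸 G P (f j)).Reg335 c35 α₀ U → IsUnit (XY (f j).toKIdx (par j) (GpY (f j).toKIdx (par j)) U))
    (hsym : ∀ j (U : CfgY 𝔸 (f j).toKIdx) (z w : SiteY (f j).toKIdx), par j U z w = (par j U w z)⁻¹)
    -- the G-side displayed laws
    (hunitA : ∀ j (α₀ : ℝ) (U : CfgY 𝔸 (f j).toKIdx), MInv ≤ (geo9Y (f j)).M → 0 < α₀ → (geo9Y (f j)).M * α₀ ≤ aInv →
      (bg9YC 𝔸 G P (f j)).Reg335 c35 α₀ U → IsUnit (deltaAY (f j).toKIdx (par j) (parB j) (GpY (f j).toKIdx (par j)) U))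
    (hparB : ∀ j (U : CfgY 𝔸 (f j).toKIdx), GVal G (f j).toKIdx U → ∀ y f', parB j U y f' ∈ G) (hb₁ : 0 ≤ b₁)
    (C₀ : ℝ) (hC₀ : 0 ≤ C₀)
    (hreg335P : ∀ j (α₀ : ℝ) (U : CfgY 𝔸 (f j).toKIdx), MInv ≤ (geo9Y (f j)).M → 0 < α₀ → (geo9Y (f j)).M * α₀ ≤ aInv →
      (bg9YC 𝔸 G P (f j)).Reg335 c35 α₀ U → Reg335PlaqY G (f j) (ιB j) C₀ U)
    (hC37G : ∀ j β' U a, C37 j β' U a → CplxLettersGY G (f j) (ιB j) β' U a)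
    (cVar : ℝ) (hcVar : 0 ≤ cVar) (hvarB : ∀ j β' U a, C37 j β' U a → VarParBY (f j).toKIdx (parB j) cVar β' U a)
    (hMd : 2 * ((d : ℝ) + 1) < MInv) (mN : ℕ) (hnbr : ∀ (j : J) (y' : IBondY (f j).toKIdx), (nbr (geo9Y (f j)) (2 * ((d : ℝ) + 1)) y').card ≤ mN) :
    GFrame₅ c35 (fun j => geo9Y (f j)) (fun j => (codingYx P G (f j) (C37 j) (C38 j)).bg) (fun j => KSC P G (f j) (par j) (C37 j) (C38 j)) b (Fin (d + 1))
      (fun j => SiteY (f j).toKIdx) (fun j => BlkY (f j).toKIdx × ι)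
      (fun j => KACU P G (f j) (GAY (f j).toKIdx (par j) (parB j) (GpY (f j).toKIdx (par j))) (parB j) (C37 j) (C38 j))
      (fun j => pullS (codingYx P G (f j) (C37 j) (C38 j)) (CinvY P f G par j)) :=
  { cinvFrame₃CodedOnSel P f c35 G par b ιB C37 C38 hι hG1 M₂ hM₂ hrepr hcR Cq hCq hC37 MInv aInv aW hMInv haInv haW hparG hparC hunitG hunitXG hsym with
    C₀ := C₀
    κQb := (M₂ * ∑ j, ‖b j‖) * (2 * (((ℓ + 1 : ℕ) : ℝ)) ^ (d + 1)) * Real.exp (1 * ((ℓ : ℝ) + 3))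
    cFb := (M₂ * ∑ j, ‖b j‖) * (cVar * (2 * (((ℓ + 1 : ℕ) : ℝ)) ^ (d + 1))) * Real.exp (1 * ((ℓ : ℝ) + 3))
    abar := (M₂ * ∑ j, ‖b j‖) * b₁
    cRG := fun δ => M₂ * (∑ j, ‖b j‖) + cXY (d := d) (ℓ := ℓ) b M₂ mN δ
    wBG := fun B _ => (M₂ * ∑ j, ‖b j‖) * B + 1
    wδG := fun δ => δ
    C₀_nonneg := hC₀
    κQb_nonneg := by positivity
    cFb_nonneg := by positivity
    abar_nonneg := mul_nonneg hcR.le hb₁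
    cRG_pos := fun δ hδ => add_pos_of_pos_of_nonneg hcR (cXY_nonneg (d := d) (ℓ := ℓ) b hM₂ mN δ)
    wBG_pos := fun B _ hB _ => by positivity
    wδG_pos := fun δ hδ => hδ
    rep := fun j => repY (f j).toKIdx ι
    Gb := fun j c => GbC (f j).toKIdx (parSelC G (f j).toKIdx (par j) c) (parB j) b c
    Qb := fun j c => QbC (f j).toKIdx (parB j) b c
    Qsb := fun j c => QsbC (f j).toKIdx (parB j) b c
    ab := fun j => abC (f j).toKIdx b
    F₂ := fun j c c' => F₂C (f j).toKIdx (parB j) b c c'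
    F₂s := fun j c c' => F₂sC (f j).toKIdx (parB j) b c c'
    LapB := fun j c => LapBC (f j).toKIdx b c
    L_one_le := fun j => geo9K_one_le_L (f j).toKIdx
    T_comm := fun j μ ν z => shiftY_shiftY_comm (f j).toKIdx μ ν z
    hrep := fun j q => blkC_repY (f j).toKIdx ι (ιB j) q
    hinj := fun j => repY_injective (f j).toKIdx ι
    stencilFB := fun j μ ν z => stencilFB_blkC (f j).toKIdx (ιB j) (hι j) μ ν z
    stencilSt := fun j μ z q hq => stencilSt_blkC (f j).toKIdx (ιB j) (hι j) μ z q hq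
    stencilLoc := fun j μ z q hq => stencilLoc_blkC (f j).toKIdx (ιB j) (hι j) μ z q hq
    reg335 := fun j α₀ c hM hα₀ hMa hreg => by
      obtain ⟨U, rfl, hU⟩ := (codingYx P G (f j) (C37 j) (C38 j)).exists_of_bg_Reg335 hreg
      exact hreg335P j α₀ U hM hα₀ hMa hU
    hQb := fun j α₀ c δ hM hα₀ hMa hreg hδ hδ1 => by
      letI : Fintype (geo9K (f j).toKIdx).Site := ‹∀ x : MemberY d ℓ hd hL b₀ b₁ Mstar, Fintype (geo9Y x).Site› (f j)
      obtain ⟨U, rfl, hU⟩ := (codingYx P G (f j) (C37 j) (C38 j)).exists_of_bg_Reg335 hreg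
      have h := hasMajorant_QbC (Rr := 0) (Hp := True) (f j).toKIdx (parB j) b (ιB j) (hι j) hM₂ hrepr
        (parB_contractive G (f j) (parB j) hG1 (hparB j U hU.1.1)) hδ.le
      refine hasMajorant_mono _ h fun a a' => ?_
      have hL1 : (1 : ℝ) ≤ 2 * (((ℓ + 1 : ℕ) : ℝ)) ^ (d + 1) := by
        have : (1 : ℝ) ≤ (((ℓ + 1 : ℕ) : ℝ)) ^ (d + 1) := one_le_pow₀ (by exact_mod_cast Nat.succ_le_succ (Nat.zero_le ℓ))
        linarith
      have hδ1' : δ ≤ 1 := hδ1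
      have hℓ : (0 : ℝ) ≤ (ℓ : ℝ) + 3 := by positivity
      have he : Real.exp (δ * ((ℓ : ℝ) + 3)) ≤ Real.exp (1 * ((ℓ : ℝ) + 3)) := Real.exp_le_exp.2 (by nlinarith)
      have hE0 := (Real.exp_pos (-(δ * (geo9K (f j).toKIdx).dist a a'))).le
      have hMS : 0 ≤ M₂ * ∑ j, ‖b j‖ := hcR.le
      calc M₂ * (∑ j, ‖b j‖) * (Real.exp (δ * ((ℓ : ℝ) + 3)) * Real.exp (-(δ * (geo9K (f j).toKIdx).dist a a')))
          = M₂ * (∑ j, ‖b j‖) * 1 * Real.exp (δ * ((ℓ : ℝ) + 3)) * Real.exp (-(δ * (geo9K (f j).toKIdx).dist a a')) := by ring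
        _ ≤ M₂ * (∑ j, ‖b j‖) * (2 * (((ℓ + 1 : ℕ) : ℝ)) ^ (d + 1)) * Real.exp (1 * ((ℓ : ℝ) + 3)) *
              Real.exp (-(δ * (geo9K (f j).toKIdx).dist a a')) := by gcongr
    hQsb := fun j α₀ c δ hM hα₀ hMa hreg hδ hδ1 => by
      letI : Fintype (geo9K (f j).toKIdx).Site := ‹∀ x : MemberY d ℓ hd hL b₀ b₁ Mstar, Fintype (geo9Y x).Site› (f j)
      obtain ⟨U, rfl, hU⟩ := (codingYx P G (f j) (C37 j) (C38 j)).exists_of_bg_Reg335 hreg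
      have h := hasMajorant_QsbC (Rr := 0) (Hp := True) (f j).toKIdx (parB j) b (ιB j) (hι j) hM₂ hrepr
        (parB_contractive G (f j) (parB j) hG1 (hparB j U hU.1.1)) hδ.le
      refine hasMajorant_mono _ h fun a a' => ?_
      have hδ1' : δ ≤ 1 := hδ1
      have hℓ : (0 : ℝ) ≤ (ℓ : ℝ) + 3 := by positivity
      have he : Real.exp (δ * ((ℓ : ℝ) + 3)) ≤ Real.exp (1 * ((ℓ : ℝ) + 3)) := Real.exp_le_exp.2 (by nlinarith)
      have hMS : 0 ≤ M₂ * ∑ j, ‖b j‖ := hcR.le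
      calc M₂ * (∑ j, ‖b j‖) * (2 * (((ℓ + 1 : ℕ) : ℝ)) ^ (d + 1) * Real.exp (δ * ((ℓ : ℝ) + 3)) * Real.exp (-(δ * (geo9K (f j).toKIdx).dist a a')))
          = M₂ * (∑ j, ‖b j‖) * (2 * (((ℓ + 1 : ℕ) : ℝ)) ^ (d + 1)) * Real.exp (δ * ((ℓ : ℝ) + 3)) * Real.exp (-(δ * (geo9K (f j).toKIdx).dist a a')) := by
            ring
        _ ≤ M₂ * (∑ j, ‖b j‖) * (2 * (((ℓ + 1 : ℕ) : ℝ)) ^ (d + 1)) * Real.exp (1 * ((ℓ : ℝ) + 3)) *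
              Real.exp (-(δ * (geo9K (f j).toKIdx).dist a a')) := by gcongr
    ha324 := fun j => by
      letI : Fintype (geo9K (f j).toKIdx).Site := ‹∀ x : MemberY d ℓ hd hL b₀ b₁ Mstar, Fintype (geo9Y x).Site› (f j)
      refine hasMajorant_mono _ (hasMajorant_abC (Rr := 0) (Hp := True) (f j).toKIdx b (ιB j) (hι j) hM₂ hrepr hb₁) fun a a' => ?_
      split_ifs <;> first | exact le_of_eq (mul_assoc _ _ _).symm | exact le_of_eq (mul_zero _) | simp_all
    reg_ginv := fun j α₀ c hM hα₀ hMa hreg => by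
      obtain ⟨U, rfl, hU⟩ := (codingYx P G (f j) (C37 j) (C38 j)).exists_of_bg_Reg335 hreg
      have hR : InRegY G (f j).toKIdx (par j) U := ⟨hU.1.1, hparG j α₀ U hM hα₀ hMa hU⟩
      dsimp only [cinvFrame₃CodedOnSel, gpFrame₂CodedOnSel]
      erw [parSelC_base_of_inRegY G (f j).toKIdx (par j) hR]
      exact reg_ginv_base G (f j) (par j) (parB j) b U hU.1.1 (hunitA j α₀ U hM hα₀ hMa hU)
    gb_eq_cplx := fun j α₁ c c' X hα₁ h37 h1 h2 => by
      obtain ⟨U, a, rfl, rfl, hC⟩ := (codingYx P G (f j) (C37 j) (C38 j)).exists_of_bg_Cplx337 h37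
      exact (gb_eq_cplx_pair G (f j) (selY G (f j).toKIdx (par j) U) (parB j) b U (hC37 j α₁ U a hC).1 a X h1 h2).2
    qb_mul := fun j α₁ c c' hα₁ h37 => by
      obtain ⟨U, a, rfl, rfl, hC⟩ := (codingYx P G (f j) (C37 j) (C38 j)).exists_of_bg_Cplx337 h37
      exact ⟨qbC_prod (f j).toKIdx (parB j) b U a, qsbC_prod (f j).toKIdx (parB j) b U a⟩
    hF₂ := fun j α₁ c c' hα₁ h37 δ hδ hδ1 => by
      letI : Fintype (geo9K (f j).toKIdx).Site := ‹∀ x : MemberY d ℓ hd hL b₀ b₁ Mstar, Fintype (geo9Y x).Site› (f j)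
      obtain ⟨U, a, rfl, rfl, hC⟩ := (codingYx P G (f j) (C37 j) (C38 j)).exists_of_bg_Cplx337 h37
      have hcv : 0 ≤ cVar * α₁ := mul_nonneg hcVar hα₁.le
      have hv := hvarB j α₁ U a hC
      have hδ1' : δ ≤ 1 := hδ1
      have hℓ : (0 : ℝ) ≤ (ℓ : ℝ) + 3 := by positivity
      have he : Real.exp (δ * ((ℓ : ℝ) + 3)) ≤ Real.exp (1 * ((ℓ : ℝ) + 3)) := Real.exp_le_exp.2 (by nlinarith)
      have hL1 : (1 : ℝ) ≤ 2 * (((ℓ + 1 : ℕ) : ℝ)) ^ (d + 1) := by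
        have : (1 : ℝ) ≤ (((ℓ + 1 : ℕ) : ℝ)) ^ (d + 1) := one_le_pow₀ (by exact_mod_cast Nat.succ_le_succ (Nat.zero_le ℓ))
        linarith
      have hMS : 0 ≤ M₂ * ∑ j, ‖b j‖ := hcR.le
      constructor
      · refine hasMajorant_mono _ (hasMajorant_F₂C (Rr := 0) (Hp := True) (f j).toKIdx (parB j) b (ιB j) (hι j) hM₂ hrepr hcv hv hδ.le) fun a a' => ?_
        calc M₂ * (∑ j, ‖b j‖) * (cVar * α₁ * Real.exp (δ * ((ℓ : ℝ) + 3)) * Real.exp (-(δ * (geo9K (f j).toKIdx).dist a a')))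
            = M₂ * (∑ j, ‖b j‖) * (cVar * 1) * Real.exp (δ * ((ℓ : ℝ) + 3)) * α₁ * Real.exp (-(δ * (geo9K (f j).toKIdx).dist a a')) := by ring
          _ ≤ M₂ * (∑ j, ‖b j‖) * (cVar * (2 * (((ℓ + 1 : ℕ) : ℝ)) ^ (d + 1))) * Real.exp (1 * ((ℓ : ℝ) + 3)) * α₁ *
                Real.exp (-(δ * (geo9K (f j).toKIdx).dist a a')) := by gcongr
      · refine hasMajorant_mono _ (hasMajorant_F₂sC (Rr := 0) (Hp := True) (f j).toKIdx (parB j) b (ιB j) (hι j) hM₂ hrepr hcv hv hδ.le) fun a a' => ?_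
        calc M₂ * (∑ j, ‖b j‖) * (cVar * α₁ * (2 * (((ℓ + 1 : ℕ) : ℝ)) ^ (d + 1)) * Real.exp (δ * ((ℓ : ℝ) + 3)) *
              Real.exp (-(δ * (geo9K (f j).toKIdx).dist a a')))
            = M₂ * (∑ j, ‖b j‖) * (cVar * (2 * (((ℓ + 1 : ℕ) : ℝ)) ^ (d + 1))) * Real.exp (δ * ((ℓ : ℝ) + 3)) * α₁ *
                Real.exp (-(δ * (geo9K (f j).toKIdx).dist a a')) := by ring
          _ ≤ M₂ * (∑ j, ‖b j‖) * (cVar * (2 * (((ℓ + 1 : ℕ) : ℝ)) ^ (d + 1))) * Real.exp (1 * ((ℓ : ℝ) + 3)) * α₁ *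
                Real.exp (-(δ * (geo9K (f j).toKIdx).dist a a')) := by gcongr
    cplxG := fun j α₁ c c' hα₁ h37 => by
      obtain ⟨U, a, rfl, rfl, hC⟩ := (codingYx P G (f j) (C37 j) (C38 j)).exists_of_bg_Cplx337 h37
      exact hC37G j α₁ U a hC
    readG342 := fun j α₀ c B₀ δ hM hα₀ hMa hreg hB₀ hδ hE => by
      obtain ⟨U, rfl, hU⟩ := (codingYx P G (f j) (C37 j) (C38 j)).exists_of_bg_Reg335 hreg
      have hR : InRegY G (f j).toKIdx (par j) U := ⟨hU.1.1, hparG j α₀ U hM hα₀ hMa hU⟩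
      dsimp only [cinvFrame₃CodedOnSel, gpFrame₂CodedOnSel]
      erw [parSelC_base_of_inRegY G (f j).toKIdx (par j) hR]
      exact readG342_base P G (f j) (par j) (parB j) b (ιB j) (C37 j) (C38 j) (hι j) hM₂ hrepr (fun δ _ => cXY_nonneg (d := d) (ℓ := ℓ) b hM₂ mN δ)
        (crossReadY_KACU P G (f j) (par j) (parB j) b (ιB j) (C37 j) (C38 j) (hι j) hG1 hM₂ hrepr (hnbr j)) (lt_of_lt_of_le hMd hM) U hU.1.1 hB₀ hδ hE
    writeG342 := fun j c c' α₁ B δ hα₁ hα₁W h37 hB hδ h0 h1 h2 h3 => by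
      obtain ⟨U, a, rfl, rfl, hC⟩ := (codingYx P G (f j) (C37 j) (C38 j)).exists_of_bg_Cplx337 h37
      have hR : InRegY G (f j).toKIdx (par j) U := ⟨(hC37 j α₁ U a hC).1, hparC j α₁ U a hC⟩
      dsimp only [cinvFrame₃CodedOnSel, gpFrame₂CodedOnSel] at h0 h1 h2 h3
      erw [parSelC_prod_of_inRegY G (f j).toKIdx (par j) hR] at h0 h1 h2 h3
      have hw := writeG342_GbC P (Rr := 0) (Hp := True) G (f j) (par j) (parB j) b (ιB j) (C37 j) (C38 j) (hι j) hM₂ hrepr U (hC37 j α₁ U a hC).1 a hB h0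
        (fun ν => h1 (Sum.inl ν)) (fun ν => h2 (Sum.inr ν)) h3
      exact eBlock_mono (f j).toKIdx _ (by linarith) hw }

end GFrame

/-! ## H1G — the (3.43) bond-sector frame -/

section H1G

open Literature.MathematicalPhysics.QuantumFieldTheory.Balaban1983to89.B9SectBH1GFrameCodedYR hiding h1GFrame₆CodedOn stepH1Pos_KACU_frame_on
open Literature.MathematicalPhysics.QuantumFieldTheory.Balaban1983to89.B9SectBCodedClassR (RegExtraY bg9YC)
open Literature.MathematicalPhysics.QuantumFieldTheory.Balaban1983to89.B9SectBH1GFrameCodedY hiding h1G_transfer_KACU h1GFrame₆CodedOn stepH1Pos_KACU_frame_on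
open LatticeFieldCalculus (supDist)
open B9Eq39Adjoint (R R_smul R_zero R_sub R_add)
open B6GlobalChartV1 (PV blkV1 boxEquiv)
open B6Geom246MultiLevelTorus (geomT)
open B6Ineq2142KLevelV1 (β beta_level)
open B6KLevelCensusIndexV1 (KIdx Adm kGeo)
open B6RandomWalk (HasMajorant hasMajorant_mono BlockSupp Ineq261)
open B9Thm34Ext (toB6)
open B9FromB6 (EBlock H1Block)
open B9GeoNormsKLevelV1 (geo9K geo9K_dist_nonneg)
open B9GeoLemma21KLevelV1 (geo9Y_dist_comm geo9Y_dist_triangle geo9Y_len_pos one_le_k)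
open B9Eq310Hermitian (norm_R_le)
open B9Eq352DivFormLetters (conj coordEquiv conj_mul)
open B9Eq352GradLetters (diffLetter)
open B9Eq371GradLetters (bT bU)
open B9CoReadingCoords (cdBₗ cdsBₗ cdBₗ_apply cdsBₗ_apply)
open B9PinMembersKLevelV1 (MemberY geo9Y bg9Y)
open B9Eq360DeltaPrimeAY (AfldY)
open B9SectBGpLettersY (GVal decY decY_base blkC coordC norm_le_one_and_inv_of_mem)
open B9SectBL2DictionaryY (coordC_base_eq)
open B9SectBGpFrameCodedYR (codingYx)
open B9SectBGpFrameCodedY (CplxLettersY)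
open B9SectBGpReadingsYR (KSC)
open B9SectBGpReadingsY (baseY)
open B9SectBCodedCarrier (CCfg pullS)
open B9SectBCodedReadingsUR (KACU)
open B9SectBKerFrameCodedYR (CinvY)
open B9SectBStepWhole (StepPos StepH1Pos)
open B9RWSumsReadsNbr (nbr mem_nbr)
open B9RWSumsCompleteGeo9YNbr (len_le_of_dist_lt_M_geo9K)
open B9GeoNormsKLevelModelSignsV1 (modelSignsOn_geo9K)
open Node00 (SiteY BlkY FBondY IBondY CfgY BallY SiteParY BondParY BondOpY liftY liftY_apply holderQB cdB cdsB UboxY shiftY GAY GpY XY deltaAY deltaPrimeAY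
  bondCoordsY bondFunCoordsY)
open B9SectBGWordDeltaAY (bondOpCoordsRY GbC)
open B9SectBGReadCodedY (eta_inv_eq_abs_cf hasMajorant_of_eq hasMajorant_conj_bondOpCoordsRY GbC_eq_conj_bondOpCoordsRY bondOpCoordsRY_mul)
open B9SectBGReadYR (readG342Y_KACU)
open B9SectBGFrameCodedYRG (gFrame₅CodedOn)
open B9SectBGFrameCodedY (cXY cXY_nonneg parB_contractive)
open B9SectBGClassLettersY (Reg335PlaqY CplxLettersGY VarParBY)
open B9SectBH1GFrameV6 (H1GFrame₆ stepH1Pos_of_h1GFrame₆)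
open B9SectBH1GReadWriteYR (KACU_h1_inr_eq KACU_h1_off)
open B9SectBH1GReadWriteY (probeB norm_probeB norm_probeB_neg h1ReadB h1ReadB_le_of_probes probeB_apply)
open B9SectBH1GProbesY (lamB lamB_GbC lamB_DL_GbC lamB_GbC_DR lamB_GbC_DF lamB_conj_bondOpCoordsRY lamB_coordEquiv_bondFunCoordsY norm_map_symm_mul_diffLetter_inr
  norm_map_symm_mul_diffLetter_inl probeBC probeBC_symm blockSupp_coordEquiv_bondFun_liftY probeL_lamB_le probeR_lamB_le norm_lamB_le_of_hasMajorant
  probe_crossB_lamB_le)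
open B9SectBH1GUndiffY (HolderLipBY lenB lenB_pos probeB_undiff_le cutH_inr_nonneg)

variable [NormOneClass 𝔸] [FiniteDimensional ℝ 𝔸] {J : Type} (f : J → MemberY d ℓ hd hL b₀ b₁ Mstar)
  [∀ x : MemberY d ℓ hd hL b₀ b₁ Mstar, Fintype (geo9Y x).Site]
  [instDS : ∀ x : MemberY d ℓ hd hL b₀ b₁ Mstar, DecidableEq (geo9Y x).Site] [instNE : ∀ x : MemberY d ℓ hd hL b₀ b₁ Mstar, Nonempty (geo9Y x).Site]
  (c35 : ℝ) (G : Subgroup 𝔸ˣ) (par : ∀ j : J, SiteParY 𝔸 (f j).toKIdx) (parB : ∀ j : J, BondParY 𝔸 (f j).toKIdx)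
  {ι : Type} [Fintype ι] [DecidableEq ι] (b : Module.Basis ι ℝ 𝔸) (ιB : ∀ j : J, BlkY (f j).toKIdx → IBondY (f j).toKIdx)
  (C37 C38 : ∀ j : J, ℝ → CfgY 𝔸 (f j).toKIdx → AfldY 𝔸 (f j).toKIdx → Prop)

/-- ★★★ **THE (3.43) BOND-SECTOR FRAME `H1GFrame₆` OVER THE CODED CARRIERS OF A SUBFAMILY, AVERAGING-TRANSPORTER LAWS GUARDED** —
`B9SectBH1GFrameCodedYRG.h1GFrame₆CodedOn` on `gFrame₅CodedOnSel`; the transfer `h1G_transfer_KACU` at the base of a (3.37) pair, where the selected transporter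
IS `par` (`hparC`). [cite: Balaban1985BackgroundPropagators, Thm 3.4 p.400, Thm 3.3 p.399, (3.43) p.398, p.403 l.1–9, (3.82)–(3.86) p.407, (3.35)–(3.37) p.396; Balaban1984PropagatorsII, Lemma 2.1 p.234, (2.51)–(2.52) p.232] -/
noncomputable def h1GFrame₆CodedOnSel (hι : ∀ (j : J) (s : BlkY (f j).toKIdx), β (f j).toKIdx.hN (f j).toKIdx.D (f j).toKIdx.hk (ιB j s) = s)
    (hG1 : ∀ u : 𝔸ˣ, u ∈ G → ‖(u : 𝔸)‖ ≤ 1)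
    (M₂ : ℝ) (hM₂ : 0 ≤ M₂) (hrepr : ∀ (v : 𝔸) (j : ι), |b.repr v j| ≤ M₂ * ‖v‖) (hcR : 0 < M₂ * ∑ j, ‖b j‖)
    (Cq : ℝ) (hCq : 0 ≤ Cq) (hC37 : ∀ j β' U a, C37 j β' U a → GVal G (f j).toKIdx U ∧ CplxLettersY G (f j) (par j) (ιB j) Cq β' U a)
    (MInv aInv aW : ℝ) (hMInv : 0 < MInv) (haInv : 0 < aInv) (haW : 0 < aW)
    (hparG : ∀ j (α₀ : ℝ) (U : CfgY 𝔸 (f j).toKIdx), MInv ≤ (geo9Y (f j)).M → 0 < α₀ → (geo9Y (f j)).M * α₀ ≤ aInv →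
      (bg9YC 𝔸 G P (f j)).Reg335 c35 α₀ U → ∀ z w, par j U z w ∈ G)
    (hparC : ∀ j β' U a, C37 j β' U a → ∀ z w, par j U z w ∈ G)
    (hunitG : ∀ j (α₀ : ℝ) (U : CfgY 𝔸 (f j).toKIdx), MInv ≤ (geo9Y (f j)).M → 0 < α₀ → (geo9Y (f j)).M * α₀ ≤ aInv →
      (bg9YC 𝔸 G P (f j)).Reg335 c35 α₀ U → IsUnit (deltaPrimeAY (f j).toKIdx (par j) U))
    (hunitXG : ∀ j (α₀ : ℝ) (U : CfgY 𝔸 (f j).toKIdx), MInv ≤ (geo9Y (f j)).M → 0 < α₀ → (geo9Y (f j)).M * α₀ ≤ aInv →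
      (bg9YC 𝔸 G P (f j)).Reg335 c35 α₀ U → IsUnit (XY (f j).toKIdx (par j) (GpY (f j).toKIdx (par j)) U))
    (hsym : ∀ j (U : CfgY 𝔸 (f j).toKIdx) (z w : SiteY (f j).toKIdx), par j U z w = (par j U w z)⁻¹)
    (hunitA : ∀ j (α₀ : ℝ) (U : CfgY 𝔸 (f j).toKIdx), MInv ≤ (geo9Y (f j)).M → 0 < α₀ → (geo9Y (f j)).M * α₀ ≤ aInv →
      (bg9YC 𝔸 G P (f j)).Reg335 c35 α₀ U → IsUnit (deltaAY (f j).toKIdx (par j) (parB j) (GpY (f j).toKIdx (par j)) U))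
    (hparB : ∀ j (U : CfgY 𝔸 (f j).toKIdx), GVal G (f j).toKIdx U → ∀ y f', parB j U y f' ∈ G) (hb₁ : 0 ≤ b₁)
    (C₀ : ℝ) (hC₀ : 0 ≤ C₀)
    (hreg335P : ∀ j (α₀ : ℝ) (U : CfgY 𝔸 (f j).toKIdx), MInv ≤ (geo9Y (f j)).M → 0 < α₀ → (geo9Y (f j)).M * α₀ ≤ aInv →
      (bg9YC 𝔸 G P (f j)).Reg335 c35 α₀ U → Reg335PlaqY G (f j) (ιB j) C₀ U)
    (hC37G : ∀ j β' U a, C37 j β' U a → CplxLettersGY G (f j) (ιB j) β' U a)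
    (cVar : ℝ) (hcVar : 0 ≤ cVar) (hvarB : ∀ j β' U a, C37 j β' U a → VarParBY (f j).toKIdx (parB j) cVar β' U a)
    (hMd : 2 * ((d : ℝ) + 1) < MInv) (mN : ℕ) (hnbr : ∀ (j : J) (y' : IBondY (f j).toKIdx), (nbr (geo9Y (f j)) (2 * ((d : ℝ) + 1)) y').card ≤ mN)
    {cLip rL : ℝ} (hcLip : 0 ≤ cLip) (hrL : 0 ≤ rL)
    (hLipB : ∀ (j : J) (α₀ : ℝ) (U : CfgY 𝔸 (f j).toKIdx), (bg9YC 𝔸 G P (f j)).Reg335 c35 α₀ U → HolderLipBY (f j).toKIdx cLip rL (parB j U) U)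
    (hMr : rL + 1 < MInv) :
    H1GFrame₆ c35 (fun j => geo9Y (f j)) (fun j => (codingYx P G (f j) (C37 j) (C38 j)).bg) (fun j => KSC P G (f j) (par j) (C37 j) (C38 j)) b (Fin (d + 1))
      (fun j => SiteY (f j).toKIdx) (fun j => BlkY (f j).toKIdx × ι)
      (fun j => KACU P G (f j) (GAY (f j).toKIdx (par j) (parB j) (GpY (f j).toKIdx (par j))) (parB j) (C37 j) (C38 j))
      (fun j => pullS (codingYx P G (f j) (C37 j) (C38 j)) (CinvY P f G par j)) :=
  { gFrame₅CodedOnSel P f c35 G par parB b ιB C37 C38 hι hG1 M₂ hM₂ hrepr hcR Cq hCq hC37 MInv aInv aW hMInv haInv haW hparG hparC hunitG hunitXG hsym hunitA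
      hparB hb₁ C₀ hC₀ hreg335P hC37G cVar hcVar hvarB hMd mN hnbr with
    wHG := fun B₀ B δc Bβ => wHG6 (2 * ((d : ℝ) + 1)) (((ℓ + 1 : ℕ) : ℝ)) (∑ j, ‖b j‖) M₂ (M₂ * ∑ j, ‖b j‖) cLip rL mN B₀ B δc Bβ
    wHGδ := fun δc => δc / 6
    wHGδ_pos := fun δc hδc => by positivity
    h1G_transfer := fun j α₀ c c' α₁ B₀ B δ δc Bβ hM hα₀ hMa hreg hα₁ haW' h37 hB₀ hB hδ hδc hδcδ hE hH1 HL HR => by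
      obtain ⟨U, a, rfl, rfl, hC⟩ := (codingYx P G (f j) (C37 j) (C38 j)).exists_of_bg_Cplx337 h37
      have hR : InRegY G (f j).toKIdx (par j) U := ⟨(hC37 j α₁ U a hC).1, hparC j α₁ U a hC⟩
      dsimp only [gFrame₅CodedOnSel, cinvFrame₃CodedOnSel, gpFrame₂CodedOnSel] at HL HR
      erw [parSelC_base_of_inRegY G (f j).toKIdx (par j) hR] at HL HR
      exact h1G_transfer_KACU P c35 G (f j) (par j) (parB j) b (ιB j) (C37 j) (C38 j) (hι j) hG1 (hparB j) hM₂ hrepr hcLip hrL (hLipB j)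
        (fun _ => hnbr j) hMr (fun δ' => M₂ * (∑ j, ‖b j‖) + cXY (d := d) (ℓ := ℓ) b M₂ mN δ') α₀ (.base U) (.mult a) α₁ B₀ B δ δc Bβ hM hα₀ hMa hreg hα₁
        haW' h37 hB₀ hB hδ hδc hδcδ (le_add_of_nonneg_right (cXY_nonneg (d := d) (ℓ := ℓ) b hM₂ mN δ)) hE hH1 HL HR }


end H1G

/-! ## E4H2G — the (3.44)∕(3.45) bond-sector frame -/

section E4H2G

open Literature.MathematicalPhysics.QuantumFieldTheory.Balaban1983to89.B9SectBE4H2GFrameCodedYR hiding e4h2GFrame₆CodedOn stepE4Pos_KACU_frame_on stepH2Pos_KACU_frame_on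
open Literature.MathematicalPhysics.QuantumFieldTheory.Balaban1983to89.B9SectBCodedClassR (RegExtraY bg9YC)
open Literature.MathematicalPhysics.QuantumFieldTheory.Balaban1983to89.B9SectBE4H2GFrameCodedY hiding e4h2G_transfer_KACU e4h2GFrame₆CodedOn stepE4Pos_KACU_frame_on stepH2Pos_KACU_frame_on
open LatticeFieldCalculus (supDist)
open B9Eq39Adjoint (R R_smul R_zero R_sub R_add)
open B6GlobalChartV1 (PV blkV1 boxEquiv)
open B6Geom246MultiLevelTorus (geomT)
open B6Ineq2142KLevelV1 (β beta_level)
open B6KLevelCensusIndexV1 (KIdx Adm kGeo)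
open B6RandomWalk (HasMajorant hasMajorant_mono BlockSupp Ineq261)
open B9Thm34Ext (toB6)
open B9FromB6 (EBlock H1Block E4Block H2Block)
open B9GeoNormsKLevelV1 (geo9K geo9K_dist_nonneg geo9K_holder_mono_bond)
open B9GeoLemma21KLevelV1 (geo9Y_dist_comm geo9Y_dist_triangle geo9Y_len_pos one_le_k)
open B9Eq310Hermitian (norm_R_le)
open B9Eq352DivFormLetters (conj coordEquiv conj_neg norm_coordSymm_apply_le)
open B9Eq352GradLetters (diffLetter)
open B9Eq371GradLetters (bT bU)
open B9CoReadingCoords (cdBₗ cdsBₗ cdBₗ_apply cdsBₗ_apply)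
open B9BackgroundsKLevelV1 (shiftsV1)
open B9PinMembersKLevelV1 (MemberY geo9Y bg9Y)
open B9Eq360DeltaPrimeAY (AfldY)
open B9SectBGpLettersY (GVal decY decY_base blkC coordC norm_le_one_and_inv_of_mem)
open B9SectBL2DictionaryY (coordC_base_eq)
open B9SectBGpFrameCodedYR (codingYx)
open B9SectBGpFrameCodedY (CplxLettersY)
open B9SectBGpReadingsYR (KSC)
open B9SectBGpReadingsY (baseY)
open B9SectBCodedCarrier (CCfg pullS)
open B9SectBCodedReadingsUR (KACU)
open B9SectBKerFrameCodedYR (CinvY)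
open B9SectBStepWhole (StepPos StepE4Pos StepH2Pos StepPos.mono)
open B9RWSumsReadsNbr (nbr mem_nbr)
open B9GeoNormsKLevelModelSignsV1 (modelSignsOn_geo9K)
open Node00 (SiteY BlkY FBondY IBondY CfgY BallY SiteParY BondParY BondOpY liftY liftY_apply holderQB cdB cdsB UboxY shiftY GAY GpY XY deltaAY deltaPrimeAY
  bondCoordsY bondFunCoordsY)
open Node00.OpsYRead342CrossB (norm_cdsB_le_norm_cdB_unshift dist_blkV1_unshift_le)
open B9SectBGWordDeltaAY (bondOpCoordsRY GbC)
open B9SectBGReadCodedY (eta_inv_eq_abs_cf hasMajorant_of_eq hasMajorant_conj_bondOpCoordsRY GbC_eq_conj_bondOpCoordsRY bondOpCoordsRY_mul bondOpCoordsRY_cdBₗ bondOpCoordsRY_cdsBₗ diffLetter_abs_eq)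
open B9SectBGReadYR (readG342Y_KACU)
open B9SectBGFrameCodedYRG (gFrame₅CodedOn)
open B9SectBGFrameCodedY (cXY cXY_nonneg parB_contractive)
open B9SectBGClassLettersY (Reg335PlaqY CplxLettersGY VarParBY)
open B9SectBE4H2GFrameV6 (E4H2GFrame₆ stepE4H2Pos_of_e4h2GFrame₆)
open B9SectBH1GReadWriteYR (KACU_h1_inr_eq)
open B9SectBH1GReadWriteY (probeB norm_probeB h1ReadB)
open B9SectBH1GProbesY (lamB lamB_apply' lamB_GbC lamB_DL_GbC lamB_GbC_DR lamB_conj_bondOpCoordsRY lamB_coordEquiv_bondFunCoordsY probeBC probeBC_symm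
  blockSupp_coordEquiv_bondFun_liftY probeL_lamB_le blkC_snd_eq_blkV1 blkC_bondCoordsY_snd)
open B9SectBH1GUndiffY (HolderLipBY cutH_inr_nonneg)
open B9SectBE4H2GReadWriteYR (KACU_e4_inr_eq KACU_e4_inl KACU_h2_inr_eq KACU_h2_off)
open B9SectBE4H2GReadWriteY (e4ReadB h2ReadB norm_le_e4ReadB probe_le_h2ReadB e4ReadB_le_of_forall h2ReadB_le_of_probes)

variable [NormOneClass 𝔸] [FiniteDimensional ℝ 𝔸] {J : Type} (f : J → MemberY d ℓ hd hL b₀ b₁ Mstar)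
  [∀ x : MemberY d ℓ hd hL b₀ b₁ Mstar, Fintype (geo9Y x).Site]
  [instDS : ∀ x : MemberY d ℓ hd hL b₀ b₁ Mstar, DecidableEq (geo9Y x).Site] [instNE : ∀ x : MemberY d ℓ hd hL b₀ b₁ Mstar, Nonempty (geo9Y x).Site]
  (c35 : ℝ) (G : Subgroup 𝔸ˣ) (par : ∀ j : J, SiteParY 𝔸 (f j).toKIdx) (parB : ∀ j : J, BondParY 𝔸 (f j).toKIdx)
  {ι : Type} [Fintype ι] [DecidableEq ι] (b : Module.Basis ι ℝ 𝔸) (ιB : ∀ j : J, BlkY (f j).toKIdx → IBondY (f j).toKIdx)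
  (C37 C38 : ∀ j : J, ℝ → CfgY 𝔸 (f j).toKIdx → AfldY 𝔸 (f j).toKIdx → Prop)

/-- ★★★ **THE (3.44) ∕ (3.45) BOND-SECTOR FRAME `E4H2GFrame₆` OVER THE CODED CARRIERS OF A SUBFAMILY, AVERAGING-TRANSPORTER LAWS GUARDED** —
`B9SectBE4H2GFrameCodedYRG.e4h2GFrame₆CodedOn` on `gFrame₅CodedOnSel`; the transfer `e4h2G_transfer_KACU` at the base of a (3.37) pair, where the selected
transporter IS `par` (`hparC`). [cite: Balaban1985BackgroundPropagators, Thm 3.4 p.400, Thm 3.3 p.399, (3.44)–(3.45) p.398, p.403 l.2–5, (3.82)–(3.86) p.407, (3.35)–(3.37) p.396; Balaban1984PropagatorsII, Lemma 2.1 p.234, (2.51)–(2.52) p.232] -/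
noncomputable def e4h2GFrame₆CodedOnSel (hι : ∀ (j : J) (s : BlkY (f j).toKIdx), β (f j).toKIdx.hN (f j).toKIdx.D (f j).toKIdx.hk (ιB j s) = s)
    (hG1 : ∀ u : 𝔸ˣ, u ∈ G → ‖(u : 𝔸)‖ ≤ 1)
    (M₂ : ℝ) (hM₂ : 0 ≤ M₂) (hrepr : ∀ (v : 𝔸) (j : ι), |b.repr v j| ≤ M₂ * ‖v‖) (hcR : 0 < M₂ * ∑ j, ‖b j‖)
    (Cq : ℝ) (hCq : 0 ≤ Cq) (hC37 : ∀ j β' U a, C37 j β' U a → GVal G (f j).toKIdx U ∧ CplxLettersY G (f j) (par j) (ιB j) Cq β' U a)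
    (MInv aInv aW : ℝ) (hMInv : 0 < MInv) (haInv : 0 < aInv) (haW : 0 < aW)
    (hparG : ∀ j (α₀ : ℝ) (U : CfgY 𝔸 (f j).toKIdx), MInv ≤ (geo9Y (f j)).M → 0 < α₀ → (geo9Y (f j)).M * α₀ ≤ aInv →
      (bg9YC 𝔸 G P (f j)).Reg335 c35 α₀ U → ∀ z w, par j U z w ∈ G)
    (hparC : ∀ j β' U a, C37 j β' U a → ∀ z w, par j U z w ∈ G)
    (hunitG : ∀ j (α₀ : ℝ) (U : CfgY 𝔸 (f j).toKIdx), MInv ≤ (geo9Y (f j)).M → 0 < α₀ → (geo9Y (f j)).M * α₀ ≤ aInv →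
      (bg9YC 𝔸 G P (f j)).Reg335 c35 α₀ U → IsUnit (deltaPrimeAY (f j).toKIdx (par j) U))
    (hunitXG : ∀ j (α₀ : ℝ) (U : CfgY 𝔸 (f j).toKIdx), MInv ≤ (geo9Y (f j)).M → 0 < α₀ → (geo9Y (f j)).M * α₀ ≤ aInv →
      (bg9YC 𝔸 G P (f j)).Reg335 c35 α₀ U → IsUnit (XY (f j).toKIdx (par j) (GpY (f j).toKIdx (par j)) U))
    (hsym : ∀ j (U : CfgY 𝔸 (f j).toKIdx) (z w : SiteY (f j).toKIdx), par j U z w = (par j U w z)⁻¹)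
    (hunitA : ∀ j (α₀ : ℝ) (U : CfgY 𝔸 (f j).toKIdx), MInv ≤ (geo9Y (f j)).M → 0 < α₀ → (geo9Y (f j)).M * α₀ ≤ aInv →
      (bg9YC 𝔸 G P (f j)).Reg335 c35 α₀ U → IsUnit (deltaAY (f j).toKIdx (par j) (parB j) (GpY (f j).toKIdx (par j)) U))
    (hparB : ∀ j (U : CfgY 𝔸 (f j).toKIdx), GVal G (f j).toKIdx U → ∀ y f', parB j U y f' ∈ G) (hb₁ : 0 ≤ b₁)
    (C₀ : ℝ) (hC₀ : 0 ≤ C₀)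
    (hreg335P : ∀ j (α₀ : ℝ) (U : CfgY 𝔸 (f j).toKIdx), MInv ≤ (geo9Y (f j)).M → 0 < α₀ → (geo9Y (f j)).M * α₀ ≤ aInv →
      (bg9YC 𝔸 G P (f j)).Reg335 c35 α₀ U → Reg335PlaqY G (f j) (ιB j) C₀ U)
    (hC37G : ∀ j β' U a, C37 j β' U a → CplxLettersGY G (f j) (ιB j) β' U a)
    (cVar : ℝ) (hcVar : 0 ≤ cVar) (hvarB : ∀ j β' U a, C37 j β' U a → VarParBY (f j).toKIdx (parB j) cVar β' U a)
    (hMd : 2 * ((d : ℝ) + 1) < MInv) (mN : ℕ) (hnbr : ∀ (j : J) (y' : IBondY (f j).toKIdx), (nbr (geo9Y (f j)) (2 * ((d : ℝ) + 1)) y').card ≤ mN) :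
    E4H2GFrame₆ c35 (fun j => geo9Y (f j)) (fun j => (codingYx P G (f j) (C37 j) (C38 j)).bg) (fun j => KSC P G (f j) (par j) (C37 j) (C38 j)) b (Fin (d + 1))
      (fun j => SiteY (f j).toKIdx) (fun j => BlkY (f j).toKIdx × ι)
      (fun j => KACU P G (f j) (GAY (f j).toKIdx (par j) (parB j) (GpY (f j).toKIdx (par j))) (parB j) (C37 j) (C38 j))
      (fun j => pullS (codingYx P G (f j) (C37 j) (C38 j)) (CinvY P f G par j)) :=
  { gFrame₅CodedOnSel P f c35 G par parB b ιB C37 C38 hι hG1 M₂ hM₂ hrepr hcR Cq hCq hC37 MInv aInv aW hMInv haInv haW hparG hparC hunitG hunitXG hsym hunitA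
      hparB hb₁ C₀ hC₀ hreg335P hC37G cVar hcVar hvarB hMd mN hnbr with
    wE4G := fun B δc Bε => wE4G6 (2 * ((d : ℝ) + 1)) (∑ j, ‖b j‖) M₂ B δc Bε
    wH2G := fun B δc Bβ Bε Bεβ => wH2G6 (2 * ((d : ℝ) + 1)) (∑ j, ‖b j‖) M₂ B δc Bβ Bε Bεβ
    wHGδ' := fun δc => δc / 7
    wHGδ'_pos := fun δc hδc => by positivity
    e4h2G_transfer := fun j α₀ c c' α₁ B₀ B δ δc Bβ Bε Bεβ hM hα₀ hMa hreg hα₁ haW' h37 hB₀ hB hδ hδc hδcδ hE hHH HV HVI => by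
      obtain ⟨U, a, rfl, rfl, hC⟩ := (codingYx P G (f j) (C37 j) (C38 j)).exists_of_bg_Cplx337 h37
      have hR : InRegY G (f j).toKIdx (par j) U := ⟨(hC37 j α₁ U a hC).1, hparC j α₁ U a hC⟩
      dsimp only [gFrame₅CodedOnSel, cinvFrame₃CodedOnSel, gpFrame₂CodedOnSel] at HV HVI
      erw [parSelC_base_of_inRegY G (f j).toKIdx (par j) hR] at HV HVI
      exact e4h2G_transfer_KACU P c35 G (f j) (par j) (parB j) b (ιB j) (C37 j) (C38 j) (hι j) hG1 hM₂ hrepr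
        (fun δ' => M₂ * (∑ j, ‖b j‖) + cXY (d := d) (ℓ := ℓ) b M₂ mN δ') α₀ (.base U) (.mult a) α₁ B₀ B δ δc Bβ Bε Bεβ hM hα₀ hMa hreg hα₁ haW' h37
        hB₀ hB hδ hδc hδcδ (le_add_of_nonneg_right (cXY_nonneg (d := d) (ℓ := ℓ) b hM₂ mN δ)) hE hHH HV HVI }


end E4H2G

end Literature.MathematicalPhysics.QuantumFieldTheory.Balaban1983to89.B9SectBGFramesSelY

end
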